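import Summits.SmoothPoincare4.SmoothPoincare4.Theses.WeakReductionDescent
import Literature.Topology.FourManifolds.SphereTrisectionsSectors
import Literature.Topology.FourManifolds.TrisectionFunctorGKNaturality

/-!
# Birth attack on crux `WeakReductionDescent.MinimalWeaklyReducibleFromFour` (X₂ = K1 for `4 ≤ g`) — findings: SPC4-shielded (`S → C` proved), `K1 → C` (C is K1 minus rung 3; exactness `K1 ↔ K1@3 ∧ C` proved), a kill = an exotic S⁴ of minimal trisection genus ≥ 4 with a strongly irreducible minimal trisection, `C → S` unavailable, trisection hypothesis load-bearing, threshold `4 ≤ g` is exactly the rung boundary; faithful to AZ25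

Seat refuter-rattack-stmt-SmoothPoincare4-18019-0, 2026-08-17 (crux attack at birth).  Route
`route-SmoothPoincare4-WeakReductionDescent` rev 4, crux rank 5, item stmt-SmoothPoincare4-18019,
filed by planner-rrepair-SmoothPoincare4-WeakReductionD-d4552491-0 as piece X₂ (`stub_fromFour`)
of the rung split of K1 = `MinimalWeaklyReducible` (stmt-SmoothPoincare4-17907,
`Cruxes/MinimalWeaklyReducible/Lines/rung_split.lean`).  The decl is K1 VERBATIM with `3 ≤ g`
replaced by `4 ≤ g`; every finding of K1's birth attack
(`Cruxes/MinimalWeaklyReducible/BirthAttack.lean`, refuter-rattack-stmt-SmoothPoincare4-17907-0)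
transfers, and the shield lemmas of §(a) re-derive its argument for self-containedness (crux
workfiles are not importable modules); credit there and to refuter-rattack-…-17834-0.

Kernel-checked content (this file is sorry-free):

* (c) `fromFour_iff` — the `let`-bound weak-reducibility clause factored as `WR M T` and the
  minimality clause as `IsMinimalGenus M g` (`Iff.rfl`): the conclusion mentions neither `g`, `k`
  nor `e`; `fromFour_iff_forall_at` — C is the conjunction of the rungs `g₀ ≥ 4` of K1.
* (a) SHIELD `S → C`: `fromFour_of_spc4 : SmoothPoincare4 → MinimalWeaklyReducibleFromFour`, by
  VACUITY of `IsGKTrisection M g k T ∧ 4 ≤ g ∧ minimal` under SPC4: the round `S⁴` carries GK's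
  genus-`0` trisection (`sphere_genusZero_gkTrisection_holds`, PROVED in tree), transported along
  the diffeomorphism SPC4 provides (`IsGKTrisection.image_diffeomorph'`, PROVED), so no genus
  `≥ 1` is minimal for an `M ≅ S⁴`.  And `fromFour_of_K1 : MinimalWeaklyReducible → C` (C is a
  restriction of K1).
* (b) KILL CRITERION: `not_spc4_of_not_fromFour`, `not_K1_of_not_fromFour`,
  `exotic_of_not_fromFour` — a refutation of C is an exotic 4-sphere: a smooth homotopy 4-sphere
  whose MINIMAL trisection genus is some `g ≥ 4`, with a minimal GK-trisection that is NOT weakly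
  reducible (strongly irreducible: no disjoint non-separating pair `c, c′`, `c` compressing in one
  handlebody of the spine, `c′` in the other two), admitting no diffeomorphism to `S⁴`.  No
  refutation short of `¬ SmoothPoincare4`; no finite / decidable instance exists (no certified
  compute applies).
* (d) EXACTNESS OF THE RUNG SPLIT: `K1_iff_atThree_and_fromFour :
  MinimalWeaklyReducible ↔ MinimalWeaklyReducibleAt 3 ∧ MinimalWeaklyReducibleFromFour` — C is
  EXACTLY "K1 minus rung 3", nothing is lost or smuggled; `K1_iff_fromFour_of_noMinimalGenus_three`
  — modulo "no homotopy 4-sphere has minimal trisection genus 3" (which is what the sibling pieces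
  X₁ `DependentTripleAtThree` + X_F `DependentTripleGenusThreeStandard` give:
  `noMinimalGenus_three_of_pieces`) C ↔ K1, i.e. the glue item `MinimalWeaklyReducibleOfRungs`
  re-derived (`minimalWeaklyReducible_of_pieces'`), confirming the planner's "provable now".
* (e) THRESHOLD `4 ≤ g`: `fromFour_iff_ge_one_of` — modulo `LowGenusBase` (MZ17/MSZ16) AND
  `NoMinimalGenus 3`, C is equivalent to K1 with threshold `1 ≤ g`; WITHOUT the genus-3 input the
  threshold cannot be lowered to 3 for free (that difference IS rung 3 = the open (3;1,1,1)
  frontier, `Cruxes/MinimalWeaklyReducible/BirthAttack.lean` (d)); it can never be lowered to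
  `0 ≤ g` (round `S⁴`, genus-0 minimal trisection, `F = S²` has no non-separating circle —
  Jordan–Schoenflies, paper witness).
* (f) NOT DECORATION: `wr_false_without_trisection_four` — dropping `IsGKTrisection M g k T` (and
  minimality), keeping the bare binders, `e : M ≃ₕ S⁴` and `4 ≤ g`, the statement is FALSE:
  `M = S⁴`, `T = fun _ ↦ ∅` (empty central surface; a curve is the range of a map from the
  nonempty circle).  Any proof must use the trisection hypothesis.
* (g) C DOES NOT RESTATE THE SUMMIT BY GENUS FOR FREE: `fromFour_of_noMinimalGenus_ge_four` —
  "no homotopy sphere has minimal trisection genus ≥ 4" implies C (vacuity), but the converse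
  `C → NoMinimalGenus g₀ (g₀ ≥ 4)` is NOT derivable without K2 `WeakReductionReduces` +
  `ReducibleSplits` + induction (that is the route's `closes`); so C is genuinely weaker than
  "SPC4 above genus 3" in logical form — the weak-reduction vocabulary carries content at g ≥ 4
  (unlike rung 3, where modulo AZ25 Thm 1.3 it carries none).

Paper findings (not formalisable here; for the prover / planner):

* FAITHFULNESS (as for K1): arXiv:2503.04607 p. 2 L13–15 "T is weakly reducible if there are
  disjoint non-separating curves c and c′ such that c bounds a disk in one of the three
  handlebodies, and c′ bounds a disk in the other two"; §2 p. 6; Remark 2.5.  The decl's clause is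
  verbatim `Literature.Topology.FourManifolds.Trisection.isWeaklyReducible_iff` (inlined shape),
  symmetrised over the label `p`; `BoundsDisc` = properly embedded smooth disc
  (`range d ∩ F = c`); `NonSep c` = `IsConnected (F ∖ c)` ⇒ `c` essential and `F ∖ c ≠ ∅`.
  No junk operators (no `/`, ℕ-subtraction, `sSup`, `tsum`); quantifier order = informal text
  (∀ M e g k T, hyp → ∃ p c c′); minimality is GLOBAL (over all GK-trisections of M of every
  type), as the card intends; `k` unrestricted (χ = 2 ⇒ g = Σ kᵢ is the PROVED tree theorem
  `gkTrisection_genus_eq_sum_of_homotopyEquiv_sphere_holds`, available to the prover; with MSZ16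
  the first rung g = 4 has types (4;2,1,1), (4;2,2,0) up to relabelling).
* SEMANTICS the prover must know (as for K1): the witnessing label `p` needs `k_p ≥ 1` (c′
  compressing on both sides of the Heegaard splitting `∂X_p = H_q ∪ H_r ≅ #^{k_p} S¹×S²` and
  non-separating in F gives a non-separating 2-sphere in `∂X_p`), so for type (4;2,2,0) the label
  p with k_p = 0 is excluded.
* MUTATION.  Drop `e : M ≃ₕ S⁴`: FALSE in kind at genus ≥ 4 for the trivial `k = 0` reason —
  `#⁴ℂP²` (4;0,0,0) and K3 (22;0,0,0) (Spreer–Tillmann: trisection genus of K3 = 22 = b₂; for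
  `#⁴ℂP²` g ≥ b₂ = 4 by χ) are minimal and admit no weak reduction (needs some k_p ≥ 1).  Drop
  minimality: OPEN but plausible-false only through NON-STANDARD trisections of S⁴ of genus ≥ 4
  (standard = stabilised genus-0 trisections of genus ≥ 2 ARE weakly reducible: in
  `#ᵍ` of genus-1 trisections of S⁴ take c′ = the doubly-compressing curve of one summand and c a
  compressing curve of the third handlebody in another summand), i.e. through 4-D Waldhausen
  (MSZ Conj. 3.11) territory — no printed counterexample; AZ25 Question 8.3's candidates are
  genus 3.  Drop `4 ≤ g` → `3 ≤ g`: that is K1 (open, rung 3 = (3;1,1,1) frontier).  Drop the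
  trisection hypothesis: FALSE, (f).
* TRIVIALITY probes (`T.lean` in the seat folder, farm rc 1 as expected): `exact?` fails on C,
  on `C → SmoothPoincare4` and on `SmoothPoincare4 → C` (the latter needs the two tree theorems
  of (a)); `simp_all` / `aesop` time out at 200k heartbeats without progress.
* LITERATURE (cheapest falsifier = lookup): no strongly irreducible MINIMAL trisection of a
  homotopy 4-sphere (or of any simply connected X with some k_p ≥ 1 and g = b₂ + Σkᵢ) is in
  print; AZ25 §8 Q8.3 candidates (double branched covers of twist-spun 2-bridge knots) are genus 3
  and non-minimal or of S_p.  Negatives index for the summit: empty.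
-/

open scoped Manifold ContDiff Topology ContinuousMap
open Set

namespace Summit.SmoothPoincare4.SmoothPoincare4.Cruxes.MinimalWeaklyReducibleFromFour.BirthAttack

set_option linter.dupNamespace false

open Literature.Topology.FourManifolds
open Summit.SmoothPoincare4.SmoothPoincare4.Theses.WeakReductionDescent

/-- The round `4`-sphere of Mathlib. -/
local notation "𝕊⁴" => (Metric.sphere (0 : EuclideanSpace ℝ (Fin 5)) 1)

/-! ### (c) The clauses, factored -/

/-- The `let`-bound conclusion of the crux, verbatim, as a predicate of the ambient manifold `M`
and the sectors `T` (it mentions neither `g`, `k` nor `e`); identical to K1's. [folklore] -/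
def WR (M : Type) [TopologicalSpace M] [ChartedSpace (EuclideanSpace ℝ (Fin 4)) M]
    (T : Fin 3 → Set M) : Prop :=
  (let F : Set M := ⋂ l, T l; let H : Fin 3 → Set M := fun p => ⋂ (l : Fin 3) (_ : l ≠ p), T l; let IsCurve : Set M → Prop := fun c => c ⊆ F ∧ ∃ γ : (Metric.sphere (0 : EuclideanSpace ℝ (Fin 2)) 1) → M, Manifold.IsSmoothEmbedding (𝓡 1) (𝓡 4) ((⊤ : ℕ∞) : WithTop ℕ∞) γ ∧ Set.range γ = c; let BoundsDisc : Set M → Set M → Prop := fun A c => ∃ d : (Metric.closedBall (0 : EuclideanSpace ℝ (Fin 2)) 1) → M, Manifold.IsSmoothEmbedding (𝓡∂ 2) (𝓡 4) ((⊤ : ℕ∞) : WithTop ℕ∞) d ∧ Set.range d ⊆ A ∧ d '' ((𝓡∂ 2).boundary (Metric.closedBall (0 : EuclideanSpace ℝ (Fin 2)) 1)) = c ∧ Set.range d ∩ F = c; let NonSep : Set M → Prop := fun c => IsConnected (F \ c); let WeaklyReducible : Prop := ∃ (p : Fin 3) (c c' : Set M), IsCurve c ∧ IsCurve c' ∧ Disjoint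 c c' ∧ NonSep c ∧ NonSep c' ∧ BoundsDisc (H p) c ∧ ∀ q : Fin 3, q ≠ p → BoundsDisc (H q) c'; WeaklyReducible)

/-- "`g` is the minimal genus of a GK-trisection of `M`" (as a bound: every GK-trisection of `M`
has genus `≥ g`) — the crux's GLOBAL minimality hypothesis, factored. [folklore] -/
def IsMinimalGenus (M : Type) [TopologicalSpace M] [ChartedSpace (EuclideanSpace ℝ (Fin 4)) M]
    (g : ℕ) : Prop :=
  ∀ (g' : ℕ) (k' : Fin 3 → ℕ) (T' : Fin 3 → Set M), IsGKTrisection M g' k' T' → g ≤ g'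

/-- The crux read back through the factorisation — `Iff.rfl`. [folklore] -/
theorem fromFour_iff :
    MinimalWeaklyReducibleFromFour ↔
      ∀ (M : Type) [TopologicalSpace M] [T2Space M] [SecondCountableTopology M]
        [ChartedSpace (EuclideanSpace ℝ (Fin 4)) M] [IsManifold (𝓡 4) ∞ M],
        (M ≃ₕ 𝕊⁴) → ∀ (g : ℕ) (k : Fin 3 → ℕ) (T : Fin 3 → Set M),
          IsGKTrisection M g k T → 4 ≤ g → IsMinimalGenus M g → WR M T :=
  Iff.rfl

/-- K1 read back through the same factorisation — `Iff.rfl`. [folklore] -/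
theorem K1_iff :
    MinimalWeaklyReducible ↔
      ∀ (M : Type) [TopologicalSpace M] [T2Space M] [SecondCountableTopology M]
        [ChartedSpace (EuclideanSpace ℝ (Fin 4)) M] [IsManifold (𝓡 4) ∞ M],
        (M ≃ₕ 𝕊⁴) → ∀ (g : ℕ) (k : Fin 3 → ℕ) (T : Fin 3 → Set M),
          IsGKTrisection M g k T → 3 ≤ g → IsMinimalGenus M g → WR M T :=
  Iff.rfl

/-- K1 / C restricted to one genus `g₀` (a "rung"). [folklore] -/
def MinimalWeaklyReducibleAt (g₀ : ℕ) : Prop :=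
  ∀ (M : Type) [TopologicalSpace M] [T2Space M] [SecondCountableTopology M]
    [ChartedSpace (EuclideanSpace ℝ (Fin 4)) M] [IsManifold (𝓡 4) ∞ M],
    (M ≃ₕ 𝕊⁴) → ∀ (k : Fin 3 → ℕ) (T : Fin 3 → Set M),
      IsGKTrisection M g₀ k T → IsMinimalGenus M g₀ → WR M T

/-- "No smooth homotopy 4-sphere (bare binders) has minimal GK-trisection genus `g₀`."
[folklore] -/
def NoMinimalGenus (g₀ : ℕ) : Prop :=
  ∀ (M : Type) [TopologicalSpace M] [T2Space M] [SecondCountableTopology M]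
    [ChartedSpace (EuclideanSpace ℝ (Fin 4)) M] [IsManifold (𝓡 4) ∞ M],
    (M ≃ₕ 𝕊⁴) → ∀ (k : Fin 3 → ℕ) (T : Fin 3 → Set M),
      IsGKTrisection M g₀ k T → ¬ IsMinimalGenus M g₀

/-- C is the conjunction of the rungs `g₀ ≥ 4`. [folklore] -/
theorem fromFour_iff_forall_at :
    MinimalWeaklyReducibleFromFour ↔ ∀ g₀, 4 ≤ g₀ → MinimalWeaklyReducibleAt g₀ := by
  constructor
  · intro h g₀ hg₀ M _ _ _ _ _ e k T hT hmin
    exact h M e g₀ k T hT hg₀ hmin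
  · intro h M _ _ _ _ _ e g k T hT hg hmin
    exact h g hg M e k T hT hmin

/-- K1 is the conjunction of the rungs `g₀ ≥ 3`. [folklore] -/
theorem K1_iff_forall_at :
    MinimalWeaklyReducible ↔ ∀ g₀, 3 ≤ g₀ → MinimalWeaklyReducibleAt g₀ := by
  constructor
  · intro h g₀ hg₀ M _ _ _ _ _ e k T hT hmin
    exact h M e g₀ k T hT hg₀ hmin
  · intro h M _ _ _ _ _ e g k T hT hg hmin
    exact h g hg M e k T hT hmin

/-- A rung with no instances holds vacuously. [folklore] -/
theorem at_of_noMinimalGenus {g₀ : ℕ} (h : NoMinimalGenus g₀) :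
    MinimalWeaklyReducibleAt g₀ := by
  intro M _ _ _ _ _ e k T hT hmin
  exact absurd hmin (h M e k T hT)

/-! ### (a) The shields `K1 → C` and `S → C` -/

/-- **C is a restriction of K1**: `MinimalWeaklyReducible → MinimalWeaklyReducibleFromFour`.
[folklore] -/
theorem fromFour_of_K1 (h : MinimalWeaklyReducible) : MinimalWeaklyReducibleFromFour :=
  fromFour_iff_forall_at.2 fun g₀ hg₀ => (K1_iff_forall_at.1 h) g₀ (by omega)

variable {M : Type} [TopologicalSpace M] [ChartedSpace (EuclideanSpace ℝ (Fin 4)) M]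
  [IsManifold (𝓡 4) ∞ M]

/-- A diffeomorphism to the round sphere pulls GK's genus-`0` trisection of `S⁴` back to a
genus-`0` GK-trisection of `M`. [folklore] -/
theorem exists_gkTrisection_genus_zero_of_diffeomorph (Φ : M ≃ₘ⟮𝓡 4, 𝓡 4⟯ 𝕊⁴) :
    ∃ T : Fin 3 → Set M, IsGKTrisection M 0 (fun _ => 0) T := by
  obtain ⟨S₀, hS₀⟩ := sphere_genusZero_gkTrisection_holds
  exact ⟨fun i => Φ.symm '' S₀ i, hS₀.isGKTrisection.image_diffeomorph' Φ.symm⟩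

/-- If `M` is diffeomorphic to `S⁴`, no genus `g ≥ 1` is the minimal trisection genus of `M`.
[folklore] -/
theorem not_isMinimalGenus_of_diffeomorph (Φ : M ≃ₘ⟮𝓡 4, 𝓡 4⟯ 𝕊⁴) {g : ℕ} (hg : 1 ≤ g) :
    ¬ IsMinimalGenus M g := by
  intro hmin
  obtain ⟨T₀, hT₀⟩ := exists_gkTrisection_genus_zero_of_diffeomorph Φ
  have := hmin 0 (fun _ => 0) T₀ hT₀
  omega

/-- Under the summit every rung `g₀ ≥ 1` is empty. [folklore] -/
theorem noMinimalGenus_of_spc4 (h : _root_.SmoothPoincare4) {g₀ : ℕ} (hg₀ : 1 ≤ g₀) :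
    NoMinimalGenus g₀ := by
  intro M _ _ _ _ _ e k T _hT
  obtain ⟨Φ⟩ := h M ‹_› ‹_› e
  exact not_isMinimalGenus_of_diffeomorph Φ hg₀

/-- "No homotopy sphere has minimal trisection genus ≥ 4" implies C (each rung vacuous). The
converse is NOT available without K2 + ReducibleSplits + induction (the route's `closes`).
[folklore] -/
theorem fromFour_of_noMinimalGenus_ge_four (h : ∀ g₀, 4 ≤ g₀ → NoMinimalGenus g₀) :
    MinimalWeaklyReducibleFromFour :=
  fromFour_iff_forall_at.2 fun g₀ hg₀ => at_of_noMinimalGenus (h g₀ hg₀)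

/-- **The crux is implied by the summit** (`S → C`, shield):
`SmoothPoincare4 → MinimalWeaklyReducibleFromFour`, by vacuity of `4 ≤ g ∧ minimal`. [folklore] -/
theorem fromFour_of_spc4 (h : _root_.SmoothPoincare4) : MinimalWeaklyReducibleFromFour :=
  fromFour_of_noMinimalGenus_ge_four fun _g₀ hg₀ => noMinimalGenus_of_spc4 h (by omega)

/-! ### (b) Kill criterion -/

/-- A refutation of the crux refutes the summit. [folklore] -/
theorem not_spc4_of_not_fromFour (h : ¬ MinimalWeaklyReducibleFromFour) :
    ¬ _root_.SmoothPoincare4 :=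
  fun hs => h (fromFour_of_spc4 hs)

/-- A refutation of the crux refutes K1 (the parent crux breaks with its piece). [folklore] -/
theorem not_K1_of_not_fromFour (h : ¬ MinimalWeaklyReducibleFromFour) :
    ¬ MinimalWeaklyReducible :=
  fun h1 => h (fromFour_of_K1 h1)

/-- **What a kill would be**: a smooth homotopy 4-sphere `M` carrying a MINIMAL GK-trisection `T`
of genus `g ≥ 4` that is NOT weakly reducible (`¬ WR M T` — a strongly irreducible minimal
trisection), and admitting no diffeomorphism to the round `S⁴`. [folklore] -/
theorem exotic_of_not_fromFour (h : ¬ MinimalWeaklyReducibleFromFour) :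
    ∃ (M : Type) (_ : TopologicalSpace M) (_ : T2Space M) (_ : SecondCountableTopology M)
      (_ : ChartedSpace (EuclideanSpace ℝ (Fin 4)) M) (_ : IsManifold (𝓡 4) ∞ M),
      Nonempty (M ≃ₕ 𝕊⁴) ∧
      (∃ (g : ℕ) (k : Fin 3 → ℕ) (T : Fin 3 → Set M), IsGKTrisection M g k T ∧ 4 ≤ g ∧
        IsMinimalGenus M g ∧ ¬ WR M T) ∧
      IsEmpty (M ≃ₘ⟮𝓡 4, 𝓡 4⟯ 𝕊⁴) := by
  rw [fromFour_iff] at h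
  push Not at h
  obtain ⟨M, _, _, _, _, _, e, g, k, T, hT, hg, hmin, hwr⟩ := h
  have h1 : 1 ≤ g := le_trans (by norm_num) hg
  exact ⟨M, ‹_›, ‹_›, ‹_›, ‹_›, ‹_›, ⟨e⟩, ⟨g, k, T, hT, hg, hmin, hwr⟩,
    ⟨fun Φ => not_isMinimalGenus_of_diffeomorph Φ h1 hmin⟩⟩

/-! ### (d) Exactness of the rung split: C is K1 minus rung 3 -/

/-- **Exactness.** K1 ↔ (rung 3) ∧ C — the piece X₂ loses nothing and smuggles nothing.
[folklore] -/
theorem K1_iff_atThree_and_fromFour :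
    MinimalWeaklyReducible ↔ MinimalWeaklyReducibleAt 3 ∧ MinimalWeaklyReducibleFromFour := by
  rw [K1_iff_forall_at, fromFour_iff_forall_at]
  constructor
  · intro h
    exact ⟨h 3 le_rfl, fun g₀ hg₀ => h g₀ (by omega)⟩
  · rintro ⟨h3, h4⟩ g₀ hg₀
    rcases Nat.lt_or_ge g₀ 4 with hlt | hge
    · obtain rfl : g₀ = 3 := by omega
      exact h3
    · exact h4 g₀ hge

/-- Modulo "no homotopy 4-sphere has minimal trisection genus 3" (the (3;1,1,1) frontier, which
the sibling pieces X₁ + X_F supply), C and K1 are EQUIVALENT. [folklore] -/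
theorem K1_iff_fromFour_of_noMinimalGenus_three (h3 : NoMinimalGenus 3) :
    MinimalWeaklyReducible ↔ MinimalWeaklyReducibleFromFour := by
  rw [K1_iff_atThree_and_fromFour]
  exact ⟨fun h => h.2, fun h => ⟨at_of_noMinimalGenus h3, h⟩⟩

/-- The sibling pieces empty rung 3: a dependent triple (X₁) on a minimal genus-3 trisection
makes `M ≅ S⁴` (X_F, AZ25 Thm 1.4), whose genus-`0` trisection contradicts minimality.
[folklore] -/
theorem noMinimalGenus_three_of_pieces (hX1 : DependentTripleAtThree)
    (hXF : DependentTripleGenusThreeStandard) : NoMinimalGenus 3 := by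
  intro M _ _ _ _ _ e k T hT hmin
  have hdt := hX1 M e k T hT (fun g' k' T' hT' => hmin g' k' T' hT')
  obtain ⟨Φ⟩ := hXF M e k T hT hdt
  exact not_isMinimalGenus_of_diffeomorph Φ (by norm_num) hmin

/-- **The glue item `MinimalWeaklyReducibleOfRungs`, re-derived** (confirms "provable now"; the
item itself is a prover's landing, this is a probe): X₁ → X_F → X₂ → K1. [folklore] -/
theorem minimalWeaklyReducible_of_pieces' : MinimalWeaklyReducibleOfRungs :=
  fun hX1 hXF hX2 =>
    (K1_iff_fromFour_of_noMinimalGenus_three (noMinimalGenus_three_of_pieces hX1 hXF)).2 hX2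

/-- Equivalently: under SPC4-at-genus-3 alone nothing distinguishes C from K1; and under the
summit both hold. [folklore] -/
theorem K1_iff_fromFour_of_spc4 (h : _root_.SmoothPoincare4) :
    MinimalWeaklyReducible ↔ MinimalWeaklyReducibleFromFour :=
  K1_iff_fromFour_of_noMinimalGenus_three (noMinimalGenus_of_spc4 h (by norm_num))

/-! ### (e) The threshold `4 ≤ g` -/

/-- Modulo the support `LowGenusBase` (MZ17 / MSZ16), rungs 1 and 2 are empty. [folklore] -/
theorem noMinimalGenus_of_lowGenusBase (h5 : LowGenusBase) {g₀ : ℕ} (h1 : 1 ≤ g₀) (h2 : g₀ ≤ 2) :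
    NoMinimalGenus g₀ := by
  intro M _ _ _ _ _ e k T hT
  obtain ⟨Φ⟩ := h5 M e g₀ k T hT h2
  exact not_isMinimalGenus_of_diffeomorph Φ h1

/-- **Threshold.** Modulo `LowGenusBase` and the genus-3 frontier `NoMinimalGenus 3`, C is
equivalent to the all-genus statement with `1 ≤ g` (every lower rung is empty).  Without
`NoMinimalGenus 3` the threshold cannot be lowered below 4 for free (rung 3 is K1's open part);
it can never be lowered to `0` (round `S⁴`: genus-0 minimal trisection, `F = S²` has no
non-separating circle; paper witness). [folklore] -/
theorem fromFour_iff_ge_one_of (h5 : LowGenusBase) (h3 : NoMinimalGenus 3) :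
    MinimalWeaklyReducibleFromFour ↔ ∀ g₀, 1 ≤ g₀ → MinimalWeaklyReducibleAt g₀ := by
  rw [fromFour_iff_forall_at]
  constructor
  · intro h g₀ hg₀
    rcases Nat.lt_or_ge g₀ 3 with hlt | hge
    · exact at_of_noMinimalGenus (noMinimalGenus_of_lowGenusBase h5 hg₀ (by omega))
    · rcases Nat.lt_or_ge g₀ 4 with hlt4 | hge4
      · obtain rfl : g₀ = 3 := by omega
        exact at_of_noMinimalGenus h3
      · exact h g₀ hge4
  · intro h g₀ hg₀
    exact h g₀ (by omega)

/-! ### (f) The trisection hypothesis is load-bearing (conclusion is not decoration) -/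

/-- With empty sectors the weak-reducibility clause fails: the central surface is empty while a
curve is the range of a map from the nonempty circle. [folklore] -/
theorem not_wr_empty (M : Type) [TopologicalSpace M] [ChartedSpace (EuclideanSpace ℝ (Fin 4)) M] :
    ¬ WR M (fun _ => (∅ : Set M)) := by
  rintro ⟨p, c, c', ⟨hcF, γ, -, hγ⟩, -⟩
  have hF : (⋂ l : Fin 3, (fun _ : Fin 3 => (∅ : Set M)) l) = ∅ := by
    simpa using (iInter_const (ι := Fin 3) (s := (∅ : Set M)))
  have hc : c = ∅ := subset_empty_iff.mp (hF ▸ hcF)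
  obtain ⟨x, hx⟩ := (NormedSpace.sphere_nonempty (x := (0 : EuclideanSpace ℝ (Fin 2)))
    (r := 1)).mpr zero_le_one
  have : γ ⟨x, hx⟩ ∈ c := hγ ▸ mem_range_self _
  simp [hc] at this

/-- **`_false_without_` the trisection hypothesis.** Dropping `IsGKTrisection M g k T` (and
minimality with it) from the crux — keeping the bare binders, `e : M ≃ₕ S⁴` and `4 ≤ g` — gives a
FALSE statement: witness the round `S⁴` itself with empty sectors. [folklore] -/
theorem wr_false_without_trisection_four :
    ¬ ∀ (M : Type) [TopologicalSpace M] [T2Space M] [SecondCountableTopology M]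
        [ChartedSpace (EuclideanSpace ℝ (Fin 4)) M] [IsManifold (𝓡 4) ∞ M],
        (M ≃ₕ 𝕊⁴) → ∀ (g : ℕ) (_k : Fin 3 → ℕ) (T : Fin 3 → Set M), 4 ≤ g → WR M T := by
  intro h
  exact not_wr_empty 𝕊⁴ (h 𝕊⁴ (ContinuousMap.HomotopyEquiv.refl 𝕊⁴) 4 (fun _ => 1)
    (fun _ => ∅) le_rfl)

/-- **Minimality-free C at the round sphere is NOT refuted by vacuity**: `S⁴` itself carries
GK-trisections of every genus? — not in the tree (stabilisation of `IsGKTrisection` is not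
vendored as a construction), so even "drop minimality" has no formal witness class here; what the
tree does give is that on `S⁴` the crux's hypotheses are unsatisfiable for every `g ≥ 1`.
[folklore] -/
theorem sphere_not_isMinimalGenus {g : ℕ} (hg : 1 ≤ g) : ¬ IsMinimalGenus 𝕊⁴ g :=
  not_isMinimalGenus_of_diffeomorph (Diffeomorph.refl (𝓡 4) 𝕊⁴ ∞) hg

end Summit.SmoothPoincare4.SmoothPoincare4.Cruxes.MinimalWeaklyReducibleFromFour.BirthAttack
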